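import Literature.NumberTheory.LFunctions.DegreeOnePrimesPNT
import Literature.NumberTheory.Sieve.FriedlanderIwaniecPrimesHyp27
import Literature.NumberTheory.Sieve.PolynomialCongruencesRootCount
import Literature.NumberTheory.Sieve.PolynomialValuesSieveSequence
import Literature.NumberTheory.Sieve.RoughNumbersCoprimeProgressions
import Literature.NumberTheory.Sieve.PolynomialCongruences
import Mathlib.RingTheory.Polynomial.Eisenstein.Basic
import Mathlib.NumberTheory.Chebyshev
import Mathlib.Analysis.PSeries
import HarnessLib

/-!
# Heath-Brown's Lemma 2.2 for `n³ + 2`, I: the small prime factors (`∑_{p ≤ 3X} v_p(n³+2) log p`)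

Second proved layer under the named fact `Irving2015_largestPrimeFactor_cubic`
(`LargestPrimeFactorCubic.lean`; A. J. Irving, arXiv:1412.0024 = Acta Arith. 171 (2015),
Thm. 1.1), after `LargestPrimeFactorCubicProofs.lean`.  Irving's Lemma 2.2 is Heath-Brown's
Lemma 2 (Proc. LMS (3) 82 (2001) 554–596): *if `αX` of the `n ∈ (X, 2X]` have
`log^{(1)}(n³+2) ≥ (1+δ) log X`, where `log^{(1)}` is the logarithm of the part of `n³ + 2` composed
of prime (ideal)s of norm `≤ 3X`, then `≫ X` of them have a prime factor `≥ X^{1+αδ/2}`*.  Its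
proof is the Chebyshev–Hooley device: `∑_n log(n³+2) = 3X log X + O(X)` while the primes `≤ 3X`
absorb only `X log X + O(X)` of it.  This file proves the latter, in rational terms
(`v_p(n³+2)` in place of prime ideals of `ℤ[∛2]`, legitimate since `N(n + ∛2) = n³ + 2`):

* `Irving2015.exists_sum_smallPart_le` — there is `C` with
  `∑_{X<n≤2X} ∑_{p≤3X} v_p(n³+2) log p ≤ X log X + C·X` for all `X ≥ 1`.

Everything is PROVED; the inputs are the tree's prime number theorem for the roots of a monic
irreducible polynomial (`LFunctions.DegreeOnePrimes.abs_sum_primesLE_rootCount_mul_log_sub_self_le_logPow`,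
Landau 1903) turned into Mertens' first theorem for `ν(p) = #{s mod p : p ∣ s³+2}` by the tree's
partial summation `FriedlanderIwaniecPrimesHyp27.mertensI_of_chebyshev`
(`exists_sum_rootCount_mul_log_div_le`: `∑_{p≤x} ν(p) log p/p ≤ log x + O(1)`, Irving's
"well-known estimate"), the uniform bound `ν(p^a) ≤ W` (`exists_polyRootCountMod_prime_pow_le`,
Hooley's Lemma 4 / Nagell), the residue-class count `A_q ≤ ν(q)(X/q + 1)`
(`card_Ioc_filter_dvd_le`, from `card_filter_dvd_eval_eq_sum` and
`BFI.abs_card_Ioc_filter_modEq_sub_le`), Chebyshev's `θ(x) ≤ x log 4` and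
`π(x) ≤ (log 4) x/log √x + √x` (Mathlib), and `x³ + 2` irreducible (Eisenstein at `2`).
Per prime `p ≤ 3X`: `∑_n v_p(n³+2) = ∑_{e ≥ 1} A_{p^e} ≤ ν(p)(X/p+1) + 2WX/p² + W [log(10X³)/log p]`
(`sum_Ioc_factorization_le`); summing with weights `log p` gives
`X(log 3X + O(1)) + Wθ(3X) + 4WX ∑ n^{-3/2} + W π(3X) log(10X³) = X log X + O(X)`.
The accounting that turns this into Lemma 2.2 is the next file
(`LargestPrimeFactorCubicChebyshev.lean`).

## References

* A. J. Irving, *The largest prime factor of `X³ + 2`*, arXiv:1412.0024; Acta Arith. 171 (2015)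
  67–80, §2 Lemma 2.2, §3 p. 5. [`Irving2014LargestPrimeFactorCubic`]
* D. R. Heath-Brown, *The largest prime factor of `X³ + 2`*, Proc. London Math. Soc. (3) 82 (2001)
  554–596, Lemma 2. [`HeathBrown2001LargestPrimeFactorCubic`]
-/

noncomputable section

open Finset Real Filter Polynomial
open scoped Nat

namespace Literature.NumberTheory.Sieve

namespace Irving2015

/-! ### The polynomial `x³ + 2` and its root counts `ν(q) = #{s mod q : q ∣ s³ + 2}` -/

/-- `x³ + 2 ∈ ℤ[x]` is irreducible (Eisenstein at `2`). [folklore] -/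
theorem irreducible_X_pow_three_add_two : Irreducible (Polynomial.X ^ 3 + Polynomial.C 2 : Polynomial ℤ) := by
  set P : Ideal ℤ := Ideal.span {(2 : ℤ)} with hP
  have hPprime : P.IsPrime := Ideal.isPrime_span_singleton_of_prime (by norm_num : Prime (2:ℤ))
  have hmonic : ((Polynomial.X ^ 3 + Polynomial.C 2 : Polynomial ℤ)).Monic := monic_X_pow_add_C _ (by norm_num)
  have hdeg : ((Polynomial.X ^ 3 + Polynomial.C 2 : Polynomial ℤ)).natDegree = 3 := natDegree_X_pow_add_C
  have hE : ((Polynomial.X ^ 3 + Polynomial.C 2 : Polynomial ℤ)).IsEisensteinAt P := by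
    refine ⟨?_, ?_, ?_⟩
    · rw [hmonic.leadingCoeff, hP, Ideal.mem_span_singleton]; norm_num
    · intro k hk
      rw [hdeg] at hk
      rw [coeff_add, coeff_X_pow, coeff_C, if_neg hk.ne, zero_add, hP, Ideal.mem_span_singleton]
      split_ifs with hk0
      · exact dvd_rfl
      · exact dvd_zero _
    · rw [coeff_add, coeff_X_pow, coeff_C, if_neg (by omega : (0 : ℕ) ≠ 3), zero_add, if_pos rfl,
        hP, Ideal.span_singleton_pow, Ideal.mem_span_singleton]
      norm_num
  exact hE.irreducible hPprime hmonic.isPrimitive (by rw [hdeg]; omega)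

/-- `x³ + 2` is monic of degree `3`. [folklore] -/
theorem monic_X_pow_three_add_two :
    ((Polynomial.X ^ 3 + Polynomial.C 2 : Polynomial ℤ)).Monic ∧ ((Polynomial.X ^ 3 + Polynomial.C 2 : Polynomial ℤ)).natDegree = 3 :=
  ⟨monic_X_pow_add_C _ (by norm_num), natDegree_X_pow_add_C⟩

/-- `q ∣ f(s)` in `ℤ` for `f = x³ + 2` is `q ∣ s³ + 2` in `ℕ`. [folklore] -/
theorem natCast_dvd_eval_iff (q s : ℕ) :
    ((q : ℤ) ∣ ((Polynomial.X ^ 3 + Polynomial.C 2 : Polynomial ℤ)).eval (s : ℤ)) ↔ q ∣ s ^ 3 + 2 := by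
  simp only [eval_add, eval_pow, eval_X, eval_C]
  exact_mod_cast Iff.rfl

/-- The tree's root count `polyRootCountMod ![x³ + 2] q` is `ν(q) = #{s < q : q ∣ s³ + 2}`.
[folklore] -/
theorem polyRootCountMod_eq_card (q : ℕ) :
    polyRootCountMod ![(Polynomial.X ^ 3 + Polynomial.C 2 : Polynomial ℤ)] q = #((range q).filter fun s : ℕ => q ∣ s ^ 3 + 2) := by
  rw [← card_filter_dvd_eval_eq_polyRootCountMod]
  congr 1
  exact filter_congr (fun s _ => natCast_dvd_eval_iff q s)

/-- **Uniform bound for `ν` on prime powers** (Hensel/Nagell; the tree's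
`exists_polyRootCountMod_prime_pow_le`): there is `W ≥ 1` with `ν(p^a) ≤ W` for every prime `p`
and every `a`. (Irving: "`ν(p^e) ≪ 1`".) [cite: Irving2014LargestPrimeFactorCubic, §3 (p. 5)] -/
theorem exists_rootCount_prime_pow_le :
    ∃ W : ℕ, 1 ≤ W ∧ ∀ p : ℕ, p.Prime → ∀ a : ℕ,
      #((range (p ^ a)).filter fun s : ℕ => p ^ a ∣ s ^ 3 + 2) ≤ W := by
  obtain ⟨M, hM, h⟩ := exists_polyRootCountMod_prime_pow_le irreducible_X_pow_three_add_two
    (by rw [monic_X_pow_three_add_two.2]; norm_num)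
  refine ⟨3 * M, by omega, fun p hp a => ?_⟩
  rw [← polyRootCountMod_eq_card]
  calc polyRootCountMod ![(Polynomial.X ^ 3 + Polynomial.C 2 : Polynomial ℤ)] (p ^ a) ≤ ((Polynomial.X ^ 3 + Polynomial.C 2 : Polynomial ℤ)).natDegree * M := h p hp a
    _ = 3 * M := by rw [monic_X_pow_three_add_two.2]

/-! ### Local counting: `A_q = #{n ∈ (X, 2X] : q ∣ n³ + 2} ≤ ν(q) (X/q + 1)` -/

/-- **Irving 2015, §3** ("`A_d = Xν(d)/d + O(ν(d))`", upper-bound form): for `q ≥ 1`,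
`#{n ∈ (X, 2X] : q ∣ n³ + 2} ≤ ν(q) · (X/q + 1)` (split by the residue of `n` mod `q`; a residue
class meets `(X, 2X]` in at most `X/q + 1` integers).
[cite: Irving2014LargestPrimeFactorCubic, §3 (p. 5)] -/
theorem card_Ioc_filter_dvd_le {q : ℕ} (hq : 0 < q) (X : ℕ) :
    (#((Ioc X (2 * X)).filter fun n : ℕ => q ∣ n ^ 3 + 2) : ℝ) ≤
      #((range q).filter fun s : ℕ => q ∣ s ^ 3 + 2) * ((X : ℝ) / q + 1) := by
  have hset : (Ioc X (2 * X)).filter (fun n : ℕ => q ∣ n ^ 3 + 2) =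
      (Ioc X (2 * X)).filter (fun n : ℕ => (q : ℤ) ∣ ((Polynomial.X ^ 3 + Polynomial.C 2 : Polynomial ℤ)).eval (n : ℤ)) :=
    filter_congr (fun n _ => (natCast_dvd_eval_iff q n).symm)
  have hroots : (range q).filter (fun s : ℕ => q ∣ s ^ 3 + 2) =
      (range q).filter (fun s : ℕ => (q : ℤ) ∣ ((Polynomial.X ^ 3 + Polynomial.C 2 : Polynomial ℤ)).eval (s : ℤ)) :=
    filter_congr (fun s _ => (natCast_dvd_eval_iff q s).symm)
  rw [hset, hroots, card_filter_dvd_eval_eq_sum _ _ hq]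
  push_cast
  rw [← nsmul_eq_mul, ← sum_const]  -- careful
  refine sum_le_sum (fun s _ => ?_)
  have h := BFI.abs_card_Ioc_filter_modEq_sub_le hq s (show X ≤ 2 * X by omega)
  have h' := (abs_le.1 h).2
  push_cast at h'
  have e : (2 * (X : ℝ) - X) / q = X / q := by ring
  rw [e] at h'
  linarith

/-! ### Mertens' first theorem for `ν` (upper bound) -/

/-- **Mertens for `ν`** (Irving: "the well-known estimate `∑_{p ≤ x} ν(p) log p/p = log x + O(1)`",
here the upper bound, from the tree's prime number theorem for the roots of a monic irreducible
polynomial `abs_sum_primesLE_rootCount_mul_log_sub_self_le_logPow` and the partial summation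
`mertensI_of_chebyshev`): there is `C` with `∑_{p ≤ x} ν(p) log p / p ≤ log x + C` for all real
`x ≥ 2`. [cite: Irving2014LargestPrimeFactorCubic, §3 (p. 5, citing Diamond–Halberstam)] -/
theorem exists_sum_rootCount_mul_log_div_le :
    ∃ C : ℝ, ∀ x : ℝ, 2 ≤ x →
      ∑ p ∈ Nat.primesLE ⌊x⌋₊, (#((range p).filter fun s : ℕ => p ∣ s ^ 3 + 2) : ℝ) * Real.log p / p ≤
        Real.log x + C := by
  obtain ⟨C, hC⟩ :=
    LFunctions.DegreeOnePrimes.abs_sum_primesLE_rootCount_mul_log_sub_self_le_logPow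
      monic_X_pow_three_add_two.1 irreducible_X_pow_three_add_two ((12 : ℕ) : ℝ)
  set b : ℕ → ℝ := fun p => (#((range p).filter fun s : ℕ => p ∣ s ^ 3 + 2) : ℝ) with hb
  have hΘ : ∀ t : ℝ, 2 ≤ t →
      |(∑ p ∈ Nat.primesLE ⌊t⌋₊, b p * Real.log p) - 1 * t| ≤ C * t / Real.log t ^ 12 := by
    intro t ht
    have h := hC t ht
    rw [Real.rpow_natCast] at h
    have hsum : ∑ p ∈ Nat.primesLE ⌊t⌋₊, b p * Real.log p =
        ∑ p ∈ Nat.primesLE ⌊t⌋₊,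
          (#((range p).filter fun n : ℕ => (p : ℤ) ∣ ((Polynomial.X ^ 3 + Polynomial.C 2 : Polynomial ℤ)).eval (n : ℤ)) : ℝ) * Real.log p := by
      refine sum_congr rfl (fun p _ => ?_)
      rw [card_filter_dvd_eval_eq_polyRootCountMod, polyRootCountMod_eq_card]
    rw [hsum, one_mul]
    exact h
  have hC0 : 0 ≤ C := by
    have h2 := (abs_nonneg _).trans (hΘ 2 le_rfl)
    by_contra hneg
    have hneg' : C < 0 := lt_of_not_ge hneg
    have : C * 2 / Real.log 2 ^ 12 < 0 :=
      div_neg_of_neg_of_pos (by linarith) (by positivity)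
    linarith
  obtain ⟨c, hc⟩ := FriedlanderIwaniecPrimesHyp27.mertensI_of_chebyshev b hΘ
  set K : ℝ := C / Real.log 2 + C / 11 with hK
  have hl2 : 0 < Real.log 2 := Real.log_pos one_lt_two
  have hK0 : 0 ≤ K := by rw [hK]; positivity
  refine ⟨c + K / Real.log 2 ^ 11, fun x hx => ?_⟩
  have h := (abs_le.1 (hc x hx)).2
  have hlx : Real.log 2 ≤ Real.log x := Real.log_le_log two_pos hx
  have hKle : K / Real.log x ^ 11 ≤ K / Real.log 2 ^ 11 :=
    div_le_div_of_nonneg_left hK0 (by positivity) (pow_le_pow_left₀ hl2.le hlx 11)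
  have hb' : ∑ p ∈ Nat.primesLE ⌊x⌋₊, b p * Real.log p / p =
      ∑ p ∈ Nat.primesLE ⌊x⌋₊,
        (#((range p).filter fun s : ℕ => p ∣ s ^ 3 + 2) : ℝ) * Real.log p / p := rfl
  rw [← hb']
  linarith

/-! ### The `p`-adic valuation as a count of prime-power divisors -/

/-- `v_p(m) = #{1 ≤ e ≤ E : p^e ∣ m}` whenever `E ≥ v_p(m)` (`m ≠ 0`). [folklore] -/
theorem factorization_eq_card_filter {m p E : ℕ} (hp : p.Prime) (hm : m ≠ 0)
    (hE : m.factorization p ≤ E) :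
    m.factorization p = #((Ico 1 (E + 1)).filter fun e => p ^ e ∣ m) := by
  have : (Ico 1 (E + 1)).filter (fun e => p ^ e ∣ m) = Ico 1 (m.factorization p + 1) := by
    ext e
    simp only [mem_filter, mem_Ico, hp.pow_dvd_iff_le_factorization hm]
    omega
  rw [this, Nat.card_Ico]
  omega

/-! ### The contribution of one prime `p` -/

/-- For a prime `p`, `X ≥ 1` and `W` a uniform bound for `ν` on prime powers:
`∑_{n ∈ (X,2X]} v_p(n³+2) ≤ ν(p)(X/p + 1) + 2WX/p² + W·E_p`, where `E_p = [log(10X³)/log p]`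
(`v_p = ∑_{1 ≤ e ≤ E_p} 1_{p^e ∣ ·}` since `n³ + 2 ≤ 10X³`; each `e` contributes
`A_{p^e} ≤ ν(p^e)(X/p^e + 1)`; for `e ≥ 2`, `ν(p^e) ≤ W` and `∑_{e ≥ 2} p^{-e} ≤ 2/p²`).
[cite: Irving2014LargestPrimeFactorCubic, §3 (p. 5)] -/
theorem sum_Ioc_factorization_le {W : ℕ}
    (hW : ∀ p : ℕ, p.Prime → ∀ a : ℕ, #((range (p ^ a)).filter fun s : ℕ => p ^ a ∣ s ^ 3 + 2) ≤ W)
    {p : ℕ} (hp : p.Prime) {X : ℕ} (hX : 1 ≤ X) :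
    ∑ n ∈ Ioc X (2 * X), (((n ^ 3 + 2).factorization p : ℕ) : ℝ) ≤
      #((range p).filter fun s : ℕ => p ∣ s ^ 3 + 2) * ((X : ℝ) / p + 1) +
        W * (2 * (X : ℝ) / (p : ℝ) ^ 2) + W * Nat.log p (10 * X ^ 3) := by
  set E := Nat.log p (10 * X ^ 3) with hE
  set S := Ioc X (2 * X) with hS
  have hp2 : (2 : ℝ) ≤ p := by exact_mod_cast hp.two_le
  have hp0 : (0 : ℝ) < p := by linarith
  -- `v_p(n³+2) = #{1 ≤ e ≤ E : p^e ∣ n³+2}` on `S`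
  have hv : ∀ n ∈ S, (n ^ 3 + 2).factorization p =
      #((Ico 1 (E + 1)).filter fun e => p ^ e ∣ n ^ 3 + 2) := by
    intro n hn
    rw [hS, mem_Ioc] at hn
    refine factorization_eq_card_filter hp (by positivity) (Nat.le_log_of_pow_le hp.one_lt ?_)
    calc p ^ (n ^ 3 + 2).factorization p ≤ n ^ 3 + 2 := Nat.ordProj_le p (by positivity)
      _ ≤ (2 * X) ^ 3 + 2 := by gcongr; exact hn.2
      _ ≤ 10 * X ^ 3 := by
          have hx3 : 1 ≤ X ^ 3 := Nat.one_le_pow _ _ hX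
          have e1 : (2 * X) ^ 3 + 2 = 8 * X ^ 3 + 2 := by ring
          rw [e1]; generalize X ^ 3 = Y at hx3; omega
  -- swap the sums
  have hswap : ∑ n ∈ S, (n ^ 3 + 2).factorization p =
      ∑ e ∈ Ico 1 (E + 1), #(S.filter fun n : ℕ => p ^ e ∣ n ^ 3 + 2) := by
    rw [sum_congr rfl hv]
    simp only [card_filter]
    exact sum_comm
  have hcast : ∑ n ∈ S, (((n ^ 3 + 2).factorization p : ℕ) : ℝ) =
      ∑ e ∈ Ico 1 (E + 1), (#(S.filter fun n : ℕ => p ^ e ∣ n ^ 3 + 2) : ℝ) := by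
    exact_mod_cast congrArg (Nat.cast (R := ℝ)) hswap
  rw [hcast]
  -- each term: `A_{p^e} ≤ ν(p^e) (X/p^e + 1)`
  have hterm : ∀ e : ℕ, (#(S.filter fun n : ℕ => p ^ e ∣ n ^ 3 + 2) : ℝ) ≤
      #((range (p ^ e)).filter fun s : ℕ => p ^ e ∣ s ^ 3 + 2) * ((X : ℝ) / (p : ℝ) ^ e + 1) := by
    intro e
    have h := card_Ioc_filter_dvd_le (pow_pos hp.pos e) X
    push_cast at h
    exact h
  -- the case `E = 0` (no terms)
  rcases Nat.eq_zero_or_pos E with hE0 | hEpos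
  · rw [hE0]
    simp only [zero_add, Ico_self, sum_empty, Nat.cast_zero, mul_zero, add_zero]
    positivity
  -- split off `e = 1`
  rw [sum_eq_sum_Ico_succ_bot (by omega : 1 < E + 1)]
  have h1 : (#(S.filter fun n : ℕ => p ^ 1 ∣ n ^ 3 + 2) : ℝ) ≤
      #((range p).filter fun s : ℕ => p ∣ s ^ 3 + 2) * ((X : ℝ) / p + 1) := by
    simpa using hterm 1
  -- the terms `e ≥ 2`
  have h2 : ∀ e ∈ Ico 2 (E + 1), (#(S.filter fun n : ℕ => p ^ e ∣ n ^ 3 + 2) : ℝ) ≤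
      W * (X : ℝ) * ((p : ℝ)⁻¹) ^ e + W := by
    intro e _
    refine (hterm e).trans ?_
    have hWe : (#((range (p ^ e)).filter fun s : ℕ => p ^ e ∣ s ^ 3 + 2) : ℝ) ≤ W := by
      exact_mod_cast hW p hp e
    have hnn : (0 : ℝ) ≤ (X : ℝ) / (p : ℝ) ^ e + 1 := by positivity
    calc (#((range (p ^ e)).filter fun s : ℕ => p ^ e ∣ s ^ 3 + 2) : ℝ) * ((X : ℝ) / (p : ℝ) ^ e + 1)
        ≤ W * ((X : ℝ) / (p : ℝ) ^ e + 1) := mul_le_mul_of_nonneg_right hWe hnn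
      _ = W * (X : ℝ) * ((p : ℝ)⁻¹) ^ e + W := by rw [inv_pow]; ring
  have hgeom : ∑ e ∈ Ico 2 (E + 1), ((p : ℝ)⁻¹) ^ e ≤ 2 / (p : ℝ) ^ 2 := by
    have hr0 : (0 : ℝ) ≤ (p : ℝ)⁻¹ := by positivity
    have hr1 : (p : ℝ)⁻¹ < 1 := inv_lt_one_of_one_lt₀ (by linarith)
    refine (geom_sum_Ico_le_of_lt_one hr0 hr1).trans ?_
    have hhalf : (p : ℝ)⁻¹ ≤ 1 / 2 := by
      rw [inv_eq_one_div]; exact one_div_le_one_div_of_le two_pos hp2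
    have hden : (1 : ℝ) / 2 ≤ 1 - (p : ℝ)⁻¹ := by linarith
    calc ((p : ℝ)⁻¹) ^ 2 / (1 - (p : ℝ)⁻¹) ≤ ((p : ℝ)⁻¹) ^ 2 / (1 / 2) :=
          div_le_div_of_nonneg_left (by positivity) (by norm_num) hden
      _ = 2 / (p : ℝ) ^ 2 := by rw [inv_pow]; ring
  calc (#(S.filter fun n : ℕ => p ^ 1 ∣ n ^ 3 + 2) : ℝ) +
        ∑ e ∈ Ico 2 (E + 1), (#(S.filter fun n : ℕ => p ^ e ∣ n ^ 3 + 2) : ℝ)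
      ≤ #((range p).filter fun s : ℕ => p ∣ s ^ 3 + 2) * ((X : ℝ) / p + 1) +
          ∑ e ∈ Ico 2 (E + 1), (W * (X : ℝ) * ((p : ℝ)⁻¹) ^ e + W) := add_le_add h1 (sum_le_sum h2)
    _ = #((range p).filter fun s : ℕ => p ∣ s ^ 3 + 2) * ((X : ℝ) / p + 1) +
          (W * (X : ℝ) * ∑ e ∈ Ico 2 (E + 1), ((p : ℝ)⁻¹) ^ e + W * ((E + 1 - 2 : ℕ) : ℝ)) := by
          rw [sum_add_distrib, ← mul_sum, sum_const, Nat.card_Ico, nsmul_eq_mul]; ring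
    _ ≤ #((range p).filter fun s : ℕ => p ∣ s ^ 3 + 2) * ((X : ℝ) / p + 1) +
          (W * (X : ℝ) * (2 / (p : ℝ) ^ 2) + W * E) := by
          gcongr
          · exact_mod_cast (by omega : E + 1 - 2 ≤ E)
    _ = _ := by ring

/-! ### Two auxiliary prime sums -/

/-- `∑_{p ≤ N} log p / p² ≤ 2 ∑_n n^{-3/2}` (`log p ≤ 2√p`). [folklore] -/
theorem sum_primesLE_log_div_sq_le (N : ℕ) :
    ∑ p ∈ Nat.primesLE N, Real.log p / (p : ℝ) ^ 2 ≤
      2 * ∑' n : ℕ, ((n : ℝ) ^ (3 / 2 : ℝ))⁻¹ := by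
  have hsum : Summable (fun n : ℕ => ((n : ℝ) ^ (3 / 2 : ℝ))⁻¹) :=
    Real.summable_nat_rpow_inv.2 (by norm_num)
  calc ∑ p ∈ Nat.primesLE N, Real.log p / (p : ℝ) ^ 2
      ≤ ∑ p ∈ Nat.primesLE N, 2 * ((p : ℝ) ^ (3 / 2 : ℝ))⁻¹ := by
        refine sum_le_sum (fun p hp => ?_)
        have hp0 : (0 : ℝ) < p := by exact_mod_cast (Nat.mem_primesLE.1 hp).2.pos
        have hlog : Real.log p ≤ (p : ℝ) ^ (1 / 2 : ℝ) / (1 / 2) :=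
          Real.log_le_rpow_div hp0.le (by norm_num)
        have hpow : (p : ℝ) ^ 2 = (p : ℝ) ^ (1 / 2 : ℝ) * (p : ℝ) ^ (3 / 2 : ℝ) := by
          rw [← Real.rpow_add hp0]; norm_num
        rw [div_le_iff₀ (by positivity), hpow]
        have h32 : (0 : ℝ) < (p : ℝ) ^ (3 / 2 : ℝ) := by positivity
        have h12 : (0 : ℝ) < (p : ℝ) ^ (1 / 2 : ℝ) := by positivity
        calc Real.log p ≤ (p : ℝ) ^ (1 / 2 : ℝ) / (1 / 2) := hlog
          _ = 2 * ((p : ℝ) ^ (3 / 2 : ℝ))⁻¹ * ((p : ℝ) ^ (1 / 2 : ℝ) * (p : ℝ) ^ (3 / 2 : ℝ)) := by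
              field_simp
    _ = 2 * ∑ p ∈ Nat.primesLE N, ((p : ℝ) ^ (3 / 2 : ℝ))⁻¹ := by rw [mul_sum]
    _ ≤ 2 * ∑' n : ℕ, ((n : ℝ) ^ (3 / 2 : ℝ))⁻¹ := by
        gcongr
        exact hsum.sum_le_tsum _ (fun n _ => by positivity)

/-- `π(3X) · log(10X³) ≤ (18 log 4 + 18) X` for `X ≥ 1` (Chebyshev's bound
`π(x) ≤ (log 4) x / log √x + √x`, `log(10X³) ≤ 3 log(3X)`, `log y ≤ 2√y`). [folklore] -/
theorem card_primesLE_mul_log_le {X : ℕ} (hX : 1 ≤ X) :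
    (#(Nat.primesLE (3 * X)) : ℝ) * Real.log ((10 * X ^ 3 : ℕ) : ℝ) ≤
      18 * Real.log 4 * X + 18 * X := by
  have hX1 : (1 : ℝ) ≤ X := by exact_mod_cast hX
  set y : ℝ := ((3 * X : ℕ) : ℝ) with hy
  have hy3 : y = 3 * (X : ℝ) := by rw [hy]; push_cast; ring
  have hy1 : (1 : ℝ) < y := by rw [hy3]; linarith
  have hy0 : (0 : ℝ) < y := by linarith
  have hlogy : 0 < Real.log y := Real.log_pos hy1
  -- `π(3X) ≤ log 4 · y / (log y / 2) + √y`
  have hpi : (#(Nat.primesLE (3 * X)) : ℝ) ≤ Real.log 4 * y / (Real.log y / 2) + Real.sqrt y := by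
    have h := Chebyshev.pi_le_log4_mul_div hy1
    rw [hy, Nat.floor_natCast, ← Nat.primesLE_card_eq_primeCounting] at h
    rw [Real.log_sqrt hy0.le] at h
    rw [hy]
    exact h
  -- `log(10X³) ≤ 3 log y`
  have hlog10 : Real.log ((10 * X ^ 3 : ℕ) : ℝ) ≤ 3 * Real.log y := by
    have e3 : 3 * Real.log y = Real.log (y ^ 3) := by
      rw [Real.log_pow]; norm_num
    rw [e3]
    refine Real.log_le_log (by positivity) ?_
    rw [hy3]; push_cast; nlinarith [pow_pos (show (0:ℝ) < X by linarith) 3]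
  -- `√y log y ≤ 2 y`
  have hsl : Real.sqrt y * Real.log y ≤ 2 * y := by
    have h := Real.log_le_rpow_div hy0.le (by norm_num : (0 : ℝ) < 1 / 2)
    rw [← Real.sqrt_eq_rpow] at h
    have hs : Real.sqrt y * Real.sqrt y = y := Real.mul_self_sqrt hy0.le
    calc Real.sqrt y * Real.log y ≤ Real.sqrt y * (Real.sqrt y / (1 / 2)) :=
          mul_le_mul_of_nonneg_left h (Real.sqrt_nonneg y)
      _ = 2 * (Real.sqrt y * Real.sqrt y) := by ring
      _ = 2 * y := by rw [hs]
  have hlog0 : 0 ≤ Real.log ((10 * X ^ 3 : ℕ) : ℝ) := Real.log_nonneg (by exact_mod_cast (by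
    have := Nat.one_le_pow 3 X hX; omega : 1 ≤ 10 * X ^ 3))
  calc (#(Nat.primesLE (3 * X)) : ℝ) * Real.log ((10 * X ^ 3 : ℕ) : ℝ)
      ≤ (Real.log 4 * y / (Real.log y / 2) + Real.sqrt y) * (3 * Real.log y) :=
        mul_le_mul hpi hlog10 hlog0 (by positivity)
    _ = 6 * Real.log 4 * y + 3 * (Real.sqrt y * Real.log y) := by field_simp; ring
    _ ≤ 6 * Real.log 4 * y + 3 * (2 * y) := by gcongr
    _ = 18 * Real.log 4 * X + 18 * X := by rw [hy3]; ring

/-! ### The small part of `∑ log(n³ + 2)` -/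

/-- **The small prime factors absorb at most a third of `∑ log(n³+2)`** (the Chebyshev–Hooley
input to Heath-Brown's Lemma 2.2 = Irving's Lemma 2.2): there is `C` with
`∑_{X < n ≤ 2X} ∑_{p ≤ 3X} v_p(n³ + 2) log p ≤ X log X + C X` for all `X ≥ 1` — i.e. the
`3X`-smooth parts of the `n³ + 2`, `n ∈ (X, 2X]`, have total logarithm `X log X + O(X)`, against
`∑ log(n³+2) ≥ 3 X log X`.  Proof: swap the sums; for each prime `p ≤ 3X` use
`sum_Ioc_factorization_le`; then Mertens for `ν` (`X ∑ ν(p) log p/p ≤ X log(3X) + O(X)`),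
Chebyshev (`∑_{p ≤ 3X} ν(p) log p ≤ W θ(3X)`), `∑_p log p/p² < ∞` and `π(3X) log(10X³) ≪ X`.
[cite: Irving2014LargestPrimeFactorCubic, Lemma 2.2 (= Heath-Brown 2001, Lemma 2)] -/
theorem exists_sum_smallPart_le :
    ∃ C : ℝ, ∀ X : ℕ, 1 ≤ X →
      ∑ n ∈ Ioc X (2 * X), ∑ p ∈ Nat.primesLE (3 * X),
          (((n ^ 3 + 2).factorization p : ℕ) : ℝ) * Real.log p ≤ X * Real.log X + C * X := by
  obtain ⟨W, -, hW⟩ := exists_rootCount_prime_pow_le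
  obtain ⟨CM, hCM⟩ := exists_sum_rootCount_mul_log_div_le
  set Z : ℝ := ∑' n : ℕ, ((n : ℝ) ^ (3 / 2 : ℝ))⁻¹ with hZ
  refine ⟨Real.log 3 + CM + 3 * W * Real.log 4 + 4 * W * Z + W * (18 * Real.log 4 + 18),
    fun X hX => ?_⟩
  set P := Nat.primesLE (3 * X) with hP
  set S := Ioc X (2 * X) with hS
  have hX0 : (0 : ℝ) ≤ X := Nat.cast_nonneg X
  have hW0 : (0 : ℝ) ≤ W := Nat.cast_nonneg W
  rw [sum_comm]
  -- per prime
  have hstep : ∀ p ∈ P, ∑ n ∈ S, (((n ^ 3 + 2).factorization p : ℕ) : ℝ) * Real.log p ≤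
      Real.log p * (#((range p).filter fun s : ℕ => p ∣ s ^ 3 + 2) * ((X : ℝ) / p + 1) +
        W * (2 * (X : ℝ) / (p : ℝ) ^ 2) + W * Nat.log p (10 * X ^ 3)) := by
    intro p hp
    have hpp := (Nat.mem_primesLE.1 hp).2
    rw [← sum_mul, mul_comm]
    exact mul_le_mul_of_nonneg_left (sum_Ioc_factorization_le hW hpp hX)
      (Real.log_nonneg (by exact_mod_cast hpp.one_lt.le))
  refine (sum_le_sum hstep).trans ?_
  have hsplit : ∑ p ∈ P, Real.log p * (#((range p).filter fun s : ℕ => p ∣ s ^ 3 + 2) *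
      ((X : ℝ) / p + 1) + W * (2 * (X : ℝ) / (p : ℝ) ^ 2) + W * Nat.log p (10 * X ^ 3)) =
      X * ∑ p ∈ P, (#((range p).filter fun s : ℕ => p ∣ s ^ 3 + 2) : ℝ) * Real.log p / p +
        ∑ p ∈ P, (#((range p).filter fun s : ℕ => p ∣ s ^ 3 + 2) : ℝ) * Real.log p +
        2 * W * X * ∑ p ∈ P, Real.log p / (p : ℝ) ^ 2 +
        W * ∑ p ∈ P, (Nat.log p (10 * X ^ 3) : ℝ) * Real.log p := by
    rw [mul_sum, mul_sum, mul_sum, ← sum_add_distrib, ← sum_add_distrib, ← sum_add_distrib]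
    refine sum_congr rfl (fun p hp => ?_)
    have hp0 : (p : ℝ) ≠ 0 := by exact_mod_cast (Nat.mem_primesLE.1 hp).2.ne_zero
    field_simp
  rw [hsplit]
  -- T1: Mertens for `ν`
  have hT1 : ∑ p ∈ P, (#((range p).filter fun s : ℕ => p ∣ s ^ 3 + 2) : ℝ) * Real.log p / p ≤
      Real.log 3 + Real.log X + CM := by
    have h := hCM ((3 * X : ℕ) : ℝ) (by exact_mod_cast (show 2 ≤ 3 * X by omega))
    rw [Nat.floor_natCast] at h
    have hl : Real.log ((3 * X : ℕ) : ℝ) = Real.log 3 + Real.log X := by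
      push_cast
      exact Real.log_mul (by norm_num) (by exact_mod_cast (show X ≠ 0 by omega))
    linarith
  -- T2: Chebyshev
  have hT2 : ∑ p ∈ P, (#((range p).filter fun s : ℕ => p ∣ s ^ 3 + 2) : ℝ) * Real.log p ≤
      W * (Real.log 4 * (3 * X)) := by
    have hθ : ∑ p ∈ P, Real.log p ≤ Real.log 4 * (3 * (X : ℝ)) := by
      have h1 : Chebyshev.theta ((3 * X : ℕ) : ℝ) = ∑ p ∈ P, Real.log p :=
        Chebyshev.theta_eq_sum_primesLE_log (3 * X)
      have h2 := Chebyshev.theta_le_log4_mul_x (x := ((3 * X : ℕ) : ℝ)) (by positivity)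
      rw [h1] at h2
      push_cast at h2
      linarith
    calc ∑ p ∈ P, (#((range p).filter fun s : ℕ => p ∣ s ^ 3 + 2) : ℝ) * Real.log p
        ≤ ∑ p ∈ P, (W : ℝ) * Real.log p := by
          refine sum_le_sum (fun p hp => ?_)
          have hpp := (Nat.mem_primesLE.1 hp).2
          have hν : (#((range p).filter fun s : ℕ => p ∣ s ^ 3 + 2) : ℝ) ≤ W := by
            have := hW p hpp 1
            rw [pow_one] at this
            exact_mod_cast this
          exact mul_le_mul_of_nonneg_right hν (Real.log_nonneg (by exact_mod_cast hpp.one_lt.le))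
      _ = W * ∑ p ∈ P, Real.log p := by rw [mul_sum]
      _ ≤ W * (Real.log 4 * (3 * X)) := mul_le_mul_of_nonneg_left hθ hW0
  -- T3
  have hT3 : ∑ p ∈ P, Real.log p / (p : ℝ) ^ 2 ≤ 2 * Z := sum_primesLE_log_div_sq_le _
  -- T4
  have hT4 : ∑ p ∈ P, (Nat.log p (10 * X ^ 3) : ℝ) * Real.log p ≤ 18 * Real.log 4 * X + 18 * X := by
    calc ∑ p ∈ P, (Nat.log p (10 * X ^ 3) : ℝ) * Real.log p
        ≤ ∑ p ∈ P, Real.log ((10 * X ^ 3 : ℕ) : ℝ) := by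
          refine sum_le_sum (fun p hp => ?_)
          rw [← Real.log_pow]
          refine Real.log_le_log (by
            have := (Nat.mem_primesLE.1 hp).2.pos
            positivity) ?_
          exact_mod_cast Nat.pow_log_le_self p (by positivity : 10 * X ^ 3 ≠ 0)
      _ = #P * Real.log ((10 * X ^ 3 : ℕ) : ℝ) := by rw [sum_const, nsmul_eq_mul]
      _ ≤ 18 * Real.log 4 * X + 18 * X := card_primesLE_mul_log_le hX
  have hZ0 : 0 ≤ Z := tsum_nonneg (fun n => by positivity)
  have key := add_le_add (add_le_add (add_le_add (mul_le_mul_of_nonneg_left (a := (X : ℝ)) hT1 hX0)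
    hT2) (mul_le_mul_of_nonneg_left (a := 2 * (W : ℝ) * X) hT3 (by positivity)))
    (mul_le_mul_of_nonneg_left (a := (W : ℝ)) hT4 hW0)
  refine key.trans (le_of_eq ?_)
  ring

end Irving2015
end Literature.NumberTheory.Sieve
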